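import Mathlib
import HarnessLib
import HarnessLib.Audit
import Summits.ValiantsHypothesis.Statement
import Literature.Computability.AlgebraicComplexity.PermanentCorrelation
import Literature.Computability.AlgebraicComplexity.DeterminantalComplexity
import Literature.Computability.AlgebraicComplexity.StandardFamilies
import Literature.Computability.AlgebraicComplexity.ValiantClasses
import HarnessLib.Audit.Status.Attr

/-!
Route: FreeFermionCLL

DORMANT since 2026-09-01T20:55:15Z (reconciler: no traction for 5 d (last activity statement-checked at 2026-08-27T19:48:46Z); parked, not closed — `ledger route dormant route-ValiantsHypothesis-FreeFermionCLL --off` to reactivate) — unstaffed, not closed; items shared with open routes are served there. `ledger route dormant <id> --off` reactivates.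

# Route FreeFermionCLL — free fermions cannot fake the permanent — correlation decay along the
principal-minor total-rank scale, read-once kernels first

It suffices to show X = PMCorrelationGap (target; card free-fermion-cll, spine): for every c there
is n₀ such that for all n ≥ n₀,
every principal-minor form P = det(I_R + diag(x_κ(1),…,x_κ(R))·K) with K ∈ ℂ^(R×R), κ : [R] → [n]²
and TOTAL RANK R ≤ 2^((log₂ n + c)^c)
has corr²(P^(n), per_n) ≤ 1/2, where P^(n) is the degree-n homogeneous component and corr²(f, per_n)
= |Σ_σ coeff_(x_σ) f|²/(n!·Σ_m |coeff_m f|²)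
is the squared cosine with the permanent in coefficient space (`permMass`, `coeffNormSq` of
PermanentCorrelation.lean). The scale R is the
principal-minor total rank of route PrincipalMinorColouring (R = Σ_e rank A_e for an affine
expression det(A₀ + Σ x_e A_e), A₀ invertible;
the card's READ MULTIPLICITY r = max_e |κ⁻¹e| is the same scale up to the factor n², r ≤ R ≤ n²r, so
the card's K3 and the total-rank law
coincide up to poly(n)). Its bottom rung R = n², κ = id is the FREE-FERMION class FF_n = {det(I +
diag(x)K) : K ∈ ℂ^(n²×n²)} — grand-canonical
partition functions of free fermions / determinantal point processes on the n² cells with fugacities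
x_ij — and the rank-2 crux ReadOnceDecay
(card K1, "free-fermion Carlen–Lieb–Loss") says sup_K corr²(FF_n^(n), per_n) ≤ C·θ^n: however
entangled, a free-fermion state is exponentially
far from n bosons. X is reached from the exchange-rate law ExpRankLaw (corr² ≤ C(R+n+1)^C θ^n, card
K3 with the rate left free; sharp form
SharpRankLaw: C n^C e^(−n) (R+1)^(log₂ e), on which Grenet, Ryser and the k-column dynamic
programmes sit exactly). Since an affine
determinantal expression of per_n of size m is, after the shift x ↦ x + J and Sylvester's identity,
a principal-minor form of total rank
≤ n²m whose degree-n component is per_n/n! (corr = 1), X forces dc(per_n) beyond quasi-polynomial,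
hence VP_ℂ ≠ VNP_ℂ. Honest strength
label: X is of border-EVH strength (per_n at angle ≥ 45° from the degree-n parts of ALL
quasi-polynomial-rank principal-minor forms),
strictly stronger than DetQP.DetqpThesis; the route bets on the exchange rate and is testable below
X at every (n, R), beginning with R = n².
Lean: `∀ c : ℕ, ∃ n₀ : ℕ, ∀ n ≥ n₀, ∀ R ≤ 2 ^ ((Nat.log 2 n + c) ^ c), ∀ (K : Matrix (Fin R) (Fin R)
ℂ) (κ : Fin R → Fin n × Fin n), 2 * ‖Literature.Computability.AlgebraicComplexity.permMass n
(MvPolynomial.homogeneousComponent n (1 + Matrix.diagonal (fun i => MvPolynomial.X (κ i)) * K.map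
(fun a : ℂ => (MvPolynomial.C a : MvPolynomial (Fin n × Fin n) ℂ))).det)‖ ^ 2 ≤ (n.factorial : ℝ) *
Literature.Computability.AlgebraicComplexity.coeffNormSq n (MvPolynomial.homogeneousComponent n (1 +
Matrix.diagonal (fun i => MvPolynomial.X (κ i)) * K.map (fun a : ℂ => (MvPolynomial.C a :
MvPolynomial (Fin n × Fin n) ℂ))).det)`

## Assembly
Pure logic over the items (sorry-free in the planner's Sketch.lean as `closes` and
`assembly_holds`): GapRefutesQP turns X, the normal form
TotalRankLeDc and the arithmetic QpArith into "dc(per_n) is not quasi-polynomially bounded", and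
DcqpToVH (VP ⊆ VQP = qp-projections of DET,
per ∈ VNP, all PROVED in tree) turns that into VP_ℂ ≠ VNP_ℂ. Deciding theorem: `closes (hX :
PMCorrelationGap) (hG : GapRefutesQP)
(hT : TotalRankLeDc) (hQ : QpArith) (hV : DcqpToVH) : ValiantsHypothesis := hV (hG hX hT hQ)`. The
laws enter only through ExpImpliesGap ∘
SharpImpliesExp; ReadOnceDecay is the R = n² rung (the theorem to prove first), CubicReadOnce /
NoQuarticReadOnce fix the finite threshold.

Rationale: WHY THIS LINE. The correlation programme (route OneNatPerBit, cards correlation-law-nat-per-bit /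
vp-orthogonal-to-per) trades Zariski non-membership for an
ANGLE to per_n calibrated by Carlen–Lieb–Loss (CarlenLiebLoss2006 Thm 1.1: corr² of a product of row
forms ≤ n!/nⁿ), but its provable rungs —
rank-bounded (single-cut, Nisan1991Noncommutative) and bounded-cancellation/monotone
(JerrumSnir1982) models — cannot even see the first
genuinely VP-hard test class: read-once principal-minor polynomials det(I + diag(x)K), whose
degree-n parts have full flattening rank across
every cut (Slater determinants are volume-law entangled) and unbounded sign cancellation, yet cost
one n²×n² determinant. This route files
that class as the bottom rung of a NEW scale — principal-minor total rank (IkenmeyerLandsberg2017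
Def. 2.8 rank-k expressions; AravindJoglekar2015
read-k determinants, Thm 1: read-k ⇒ dc ≤ nk, Thm 2: per_n ∉ ROD(ℝ) for n > 5, ℂ open; normal form
of route PrincipalMinorColouring) — along
which ONE inequality family interpolates from an extremal problem of Brascamp–Lieb/CLL type at R =
n² (analysis: CarlenLiebLoss2006's heat-flow
and row-induction proofs are the diagonal-K case) to VBP ≠ VNP with the sharp base at R = n·2^(n−1)
(Grenet2011 on the line). Imported
areas: sharp analytic inequalities for permanents (analysis), the fermionic-Gaussian fidelity/extent
dictionary of quantum information
(HebenstreitEtAl2019, DiasKoenig2024, BravyiEtAl2019: det(I + diag(x)K) ↦ quasi-free state with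
kernel K, corr ↦ fidelity with the boson
state |per_n⟩, Σ c_i f_(K_i) ↦ Gaussian rank/extent, so ReadOnceDecay is "Gaussian extent of |per_n⟩
is 2^Ω(n)"), and the principal-minor
assignment problem (AravindEtAl2026, arXiv:2309.00806, arXiv:1503.05799) for the finite thresholds.
New here and in no sibling route: the
exact identity per_3 = ½·[deg 3] det(I_9 + diag(x)·A₃) with A₃ the INTEGER adjacency matrix of the
non-attacking-rooks graph on the 3×3 board
(support CubicReadOnce; with zero diagonal a 3×3 principal minor is the sum of its two directed
3-cycles, which survive iff the three cells are
pairwise non-attacking, i.e. a transversal) and the reason it stops at n = 4 (derangements with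
2-cycles dodge an attacking pair: the path
pattern a∼b∼c gives minor 1 via (ac)(bd)), which is what NoQuarticReadOnce and ReadOnceDecay
quantify. Negatives index (Elusive candidate
curve, Grenet-rigidity uniqueness OptimalUnique/OptimalUniqueThree): untouched — those are exact
size-7 affine representations of per_3; the
objects here are degree-n components and angles.

RANKED CRUXES. #0 PMCorrelationGap (target) — X: for every c, eventually in n, every principal-minor
form det(I_R + diag(x∘κ)K) of total rank R ≤ 2^((log₂ n + c)^c) has 2·|permMass(P^(n))|² ≤
n!·coeffNormSq(P^(n)), i.e. corr²(P^(n), per_n) ≤ 1/2. (why it might fail: Border-EVH strength: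
false if per_n is a qp-projection of DET (dc(per_n) = n^O(log n) is compatible with VP ≠ VNP) or
merely lies in the ℓ²-closure of degree-n parts of qp-rank forms; nothing below Grenet's R =
n·2^(n−1) is known.) [BurgisserClausenShokrollahi1997, Grenet2011, IkenmeyerLandsberg2017,
MulmuleySohoniSIAM2001, CarlenLiebLoss2006]
#2 ReadOnceDecay (crux) — FREE-FERMION CLL (card K1): there are C and 0 < θ < 1 such that for all n
and all K ∈ ℂ^(n²×n²), |permMass([deg n] det(I + diag(x)K))|² ≤ C·θ^n·n!·coeffNormSq([deg n] det(I +
diag(x)K)) — every read-once principal-minor polynomial (free-fermion / DPP partition function on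
the n² cells) has degree-n part at squared cosine ≤ Cθ^n with per_n; diagonal K is Carlen–Lieb–Loss
(rate n!/nⁿ), conjectured sharp rate poly(n)·n!/nⁿ. [difficulty: L] (why it might fail: n = 3
attains corr = 1 (CubicReadOnce) and n = 4 reaches ≥ 0.43 ≈ 4.6× CLL numerically (card); an
algebraic family of complex kernels with corr² ≥ n^(−O(1)) — 3-cycle-type cancellations beyond the
graph kernel — kills it together with ExpRankLaw and X.) [CarlenLiebLoss2006, AravindJoglekar2015,
DiasKoenig2024, HebenstreitEtAl2019, BravyiEtAl2019,
ValiantsHypothesis/ValiantsHypothesis/free-fermion-cll]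
#3 ExpRankLaw (crux) — EXCHANGE RATE LEFT FREE (card K3, load-bearing form): there are C and 0 < θ <
1 such that for all n, R, K ∈ ℂ^(R×R), κ : [R] → [n]², |permMass(P^(n))|² ≤ C·(R + n +
1)^C·θ^n·n!·coeffNormSq(P^(n)) for P = det(I_R + diag(x∘κ)K): total rank buys correlation with per_n
only polynomially against an exponential deficit. Implies X (ExpImpliesGap) and, at R = n²,
ReadOnceDecay up to reindexing and a polynomial factor. [deps: ReadOnceDecay] [difficulty:
open-problem] (why it might fail: Border strength again: one poly-rank family with corr² decaying
slower than every θ^n (none known: twisted determinants ≤ nⁿ/n!², k-column DPs e^(k−n), partial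
Ryser sums T·n!/nⁿ) refutes it while VP ≠ VNP and even X may survive.) [IkenmeyerLandsberg2017,
CarlenLiebLoss2006, Grenet2011, BurgisserClausenShokrollahi1997,
ValiantsHypothesis/ValiantsHypothesis/correlation-law-nat-per-bit]
#4 SharpRankLaw (crux) — ONE NAT PER BIT OF TOTAL RANK (card K3, sharp form): there is C such that
for all n ≥ 1, R, K, κ, |permMass(P^(n))|² ≤ C·n^C·e^(−n)·(R+1)^(1/ln 2)·n!·coeffNormSq(P^(n)):
intercept = the free-fermion rung at the CLL rate, slope e per doubling of total rank (k-column
dynamic programme: R ≈ n²2^k, corr² = (n−k)!/(n−k)^(n−k)), endpoint Grenet/Ryser (R ≈ n·2^(n−1),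
corr = 1) exactly on the line; implies dc(per_n) ≥ 2^n/poly(n) and ExpRankLaw (SharpImpliesExp).
[deps: ExpRankLaw] [difficulty: open-problem] (why it might fail: The exponent log₂ e is pinned only
by three calibrations; any determinantal expression of per_n of total rank 2^n/n^ω(1) (none known;
Grenet 2^n − 1 is the record) or a numerically growing excess over (R+1)^(log₂ e)·n!/nⁿ inside FF_n
refutes it (ExpRankLaw survives).) [CarlenLiebLoss2006, Grenet2011, Glynn2010, JerrumSnir1982,
AravindJoglekar2015]
#9 SharpImpliesExp (support) — SharpRankLaw → ExpRankLaw with θ = e⁻¹ and C' = C + 2 (n^C ≤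
(R+n+1)^C, (R+1)^(1/ln 2) ≤ (R+n+1)², Real.rpow bookkeeping; n = 0 handled by C ≥ 1). [difficulty:
provable-now] [CarlenLiebLoss2006]
#9 ExpImpliesGap (support) — ExpRankLaw → PMCorrelationGap: for R ≤ 2^((log₂ n + c)^c) the factor
C(R+n+1)^C θ^n is eventually ≤ 1/2 because (log₂ n + c)^c = o(n) (exponential beats
quasi-polynomial; elementary real analysis with Nat.log). [difficulty: provable-now] [Burgisser2000]
#9 GapRefutesQP (support) — PMCorrelationGap → TotalRankLeDc → QpArith → dc(per_n) is not
quasi-polynomially bounded: a qp bound on dc gives (TotalRankLeDc, QpArith) a principal-minor form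
of qp total rank with per_n(x+J) = n!·P, whose degree-n component is per_n/n!
(perPoly_isHomogeneous; top component is translation invariant; homogeneousComponent of C c * P), so
permMass = 1 and n!·coeffNormSq = 1, contradicting 2 ≤ 1 at a large n. [difficulty: provable-now]
[MignonRessayre2004, IkenmeyerLandsberg2017,
Literature.Computability.AlgebraicComplexity.perPoly_isHomogeneous]
#9 TotalRankLeDc (support) — (shared verbatim with PrincipalMinorColouring stmt-3784) for every n
there is a principal-minor representation per_n(x+J) = n!·det(I_R + diag(x∘κ)K) of size R ≤
n²·dc(per_n) (Sylvester / Weinstein–Aronszajn normal form after the shift by J, per_n(J) = n! ≠ 0;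
dc attained by hasDetRepr_determinantalComplexity_holds). [difficulty: provable-now]
[IkenmeyerLandsberg2017, MignonRessayre2004, AravindJoglekar2015]
#9 QpArith (support) — (shared verbatim with PrincipalMinorColouring stmt-3785) n²·2^((log₂ n +
c)^c) ≤ 2^((log₂ n + c')^c') for some c' depending on c and all n. [difficulty: provable-now]
[Burgisser2000]
#9 DcqpToVH (support) — (shared verbatim with DetQP / PrincipalMinorColouring / GrenetZeon
stmt-3786) dc(per_n) not qp-bounded ⇒ VP_ℂ ≠ VNP_ℂ, composing the PROVED facts
isQPBounded_determinantalComplexity_of_isVPFamily_holds, mem_VP_ofFintype_iff_holds,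
perFamily_mem_VNP_holds and Hub.valiantsHypothesis_of_not_isVPFamily_per. [difficulty: provable-now]
[BurgisserClausenShokrollahi1997, Valiant1979, Burgisser2000,
Literature.Computability.AlgebraicComplexity.isQPBounded_determinantalComplexity_of_isVPFamily_holds]
#9 CubicReadOnce (support) — per_3 IS half the cubic component of a read-once integer
principal-minor polynomial: [deg 3] det(I_9 + diag(x)·A₃) = 2·per_3, A₃(e,e') = 1 iff the cells e,
e' share neither row nor column (zero diagonal): a 3×3 principal minor of a zero-diagonal matrix is
the sum of its two directed 3-cycles, nonzero iff the three cells are pairwise non-attacking, i.e. a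
transversal. The threshold identity n* ≥ 3 of the card, in closed form (the card's numerical kernel
had 46 nonzero entries). [difficulty: provable-now] [AravindJoglekar2015,
ValiantsHypothesis/ValiantsHypothesis/free-fermion-cll]
#9 NoQuarticReadOnce (support) — threshold n* = 3: no K ∈ ℂ^(16×16) has [deg 4] det(I + diag(x)K) =
c·per_4 with c ≠ 0 (1820 quartic minor conditions on 256 − 15 effective parameters; the graph kernel
fails via the (ac)(bd) derangement, rank-4 kernels K = UVᵀ with partition frames fail by Pólya's
sign obstruction; general kernels open — numerical algebraic geometry / principal-minor-assignment
structure). Either answer is informative; a kernel that exists moves n* and threatens ReadOnceDecay.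
[difficulty: M] [AravindEtAl2026, arXiv:2309.00806, arXiv:1503.05799, AravindJoglekar2015,
ValiantsHypothesis/ValiantsHypothesis/free-fermion-cll]

TWO-LAYER PLAN. Foreseen glued splits (k ≤ 3, depth 1), filed only when a crux moves: ReadOnceDecay
⇐ NormalKernelCase (K normal / Hermitian: det K[S] are
squared volumes, a weighted CLL) → SignedPerturbation (general K as per(diag-part) plus the signed
sum over π ≠ id of coupled cycle products,
controlled by CLL Thm 3.1 sub-permanent ℓ²-bounds) → ReadOnceDecay; alternatively ReadOnceDecay ⇐
FidelityMultiplicative (sup corr² for block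
targets per_a ⊕ per_b is multiplicative, the Gaussian-extent lemma of DiasKoenig2024 in this
setting) → FiniteThreshold (sup corr² < 1 at some
n₀ uniformly enough to restrict) → ReadOnceDecay, IF a restriction lemma linking per_n to block
targets is found (not claimed). ExpRankLaw ⇐
ReadOnceDecay → ColourMerging (merging r modes of one variable costs at most a factor poly·r^O(1) in
corr²: the only bridge from K1 to K3, and
where VBP-hardness lives) → ExpRankLaw.

KILL CRITERIA. ¬ReadOnceDecay by a kernel family with corr² ≥ n^(−O(1)) refutes ExpRankLaw and
SharpRankLaw as well (FF_n is their R = n² case up to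
reindexing) and makes X implausible: close `refuted:ReadOnceDecay` unless the family still has corr²
→ 0 sub-exponentially (then pivot to a
sub-exponential-profile thesis with X intact). ¬PMCorrelationGap closes the route outright (and is a
striking positive result: per_n in the
ℓ²-angle-closure of qp-rank principal-minor forms). ¬SharpRankLaw alone (e.g. a
total-rank-2^n/n^ω(1) expression of per_n, or FF-numerics
exceeding (R+1)^(log₂ e)·n!/nⁿ by a growing factor) ⇒ re-fit the exponent, keep ExpRankLaw/X.
¬NoQuarticReadOnce (an exact n = 4 kernel) is
not a logical kill but moves n*; exact kernels at two consecutive new levels (n = 4, 5) ⇒ presume an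
algorithmic family (small permanents as
homogeneous components of read-once determinants) and retire in favour of an ALGORITHM card.
dc(per_n) proved qp-bounded anywhere (¬DetqpThesis)
kills X too ⇒ close; DetqpThesis/TotalRankNotQP proved elsewhere settles VH and moots the route but
not the laws.

NOT DECOMPOSED YET. The sharp constant inside FF_n (sup corr² vs poly(n)·n!/nⁿ, n ≥ 5 numerics
first); the Pfaffian/paired-state version of ReadOnceDecay
(amplitudes Pf B[S]); the general-n exact threshold statement (no read-once kernel for any n ≥ 4) of
which NoQuarticReadOnce is the first
instance; multiplicativity of sup-fidelity under ⊕ (card K2(b)) and the ℓ¹/extent corollary (every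
identity per_n = Σ c_i f_(K_i)^(n) has
Σ|c_i|·‖f_(K_i)^(n)‖ ≥ θ^(−n/2)√n!/√C) — a Cauchy–Schwarz consequence of ReadOnceDecay, not needed
by the assembly; the colour-merging bridge
ReadOnceDecay → ExpRankLaw; the implication ExpRankLaw → ReadOnceDecay (reindexing Fin (n·n) ≃ Fin n
× Fin n plus absorbing (n²+n+1)^C into
θ); characteristic p and real-field variants (corr needs an archimedean absolute value).

CHEAPEST FALSIFIER. (1) NoQuarticReadOnce as a kit job: Newton/homotopy continuation on the 1820
quartic-minor equations det K[S] = λ·[S ∈ S_4] in the 256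
entries of K (torus gauge fixed), 10³ complex starts, plus structured ansätze (block-circulant;
rank-4/5 factorised K = UVᵀ; K supported on
non-attacking pairs with complex weights) — an exact n = 4 kernel flips the card towards an
algorithm; infeasibility certificates support
ReadOnceDecay. (2) Push the card's corr² maximisation (ideator scripts gcll_*.py) to n = 5, 6:
ReadOnceDecay predicts the maximum keeps
falling by roughly e per step (CLL floor 0.038, 0.015); a plateau near 0.4 kills the line before any
proof attempt. (3) One-hour lookup:
a computed maximal overlap of fermionic Gaussian states with n-boson permanent / single-photon Fock
states; searchd was down (rc 75) while
drafting, galaxy substring searches found only DiasKoenig2024, the FCT 2015 volume and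
principal-minor-map papers (arXiv:2309.00806,
arXiv:1503.05799), none on permanent states.

NUMBERS. CLL rate n!/nⁿ (= sup corr² over products of row forms, CarlenLiebLoss2006 Thm 1.1): n = 3:
0.222; 4: 0.0938; 5: 0.0384; 6: 0.0154;
≈ √(2πn)·e^(−n). Free-fermion data (card, pure-python, seeds fixed): sup corr² = 1 at n = 3 (exact;
closed form CubicReadOnce: K = A₃, factor 2,
36 nonzero integer entries), ≥ 0.43 at n = 4 over 42 restarts (none above 0.44) = 4.6× CLL;
parameter count for an exact level-n kernel:
C(n²,n) − 1 minor conditions vs n⁴ − n² + 1 effective entries (n = 3: 83 vs 73, solvable by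
symmetry; n = 4: 1819 vs 241). Total-rank scale:
pmc(det_n) = n² (read-once), n² + 1 ≤ pmc(per_n) ≤ n·2^(n−1) (IkenmeyerLandsberg2017; Grenet2011:
dc(per_n) ≤ 2^n − 1 with n·2^(n−1) variable
entries), dc(per_n) ≥ n²/2 (MignonRessayre2004); read-k ⇒ dc ≤ n²k here (AravindJoglekar2015 Thm 1
with N = n² variables); Ryser = read-2^(n−1).
SharpRankLaw calibrations: R = n² ⇒ bound C n^(C+2.9) e^(−n) (FF intercept); k-column DP R ≈ n²2^k ⇒
e^(k−n)·poly (met); Grenet R ≈ n2^(n−1) ⇒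
(R+1)^(log₂ e) ≈ eⁿ·n^1.44/2.9 (corr = 1 allowed, nothing smaller known). Items at open: 13 (1
target, 3 cruxes, 8 support, 1 assembly).

DEFINITION REQUESTS. None needed: permMass / coeffNormSq / permCorrSq (PermanentCorrelation.lean),
HasPrincipalMinorRepr(Read) (PrincipalMinorRepr.lean),
determinantalComplexity, IsQPBounded, perPoly all exist; the items inline det(1 + diagonal (X ∘ κ) *
K.map C) exactly as route
PrincipalMinorColouring does, so TotalRankLeDc / QpArith / DcqpToVH are shared by signature.
Optional later: `ffOverlap n := ⨆ K, permCorrSq n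
([deg n] det(1 + diag X K))` if numerics items want a name.

Novelty: Searches (2026-08-15): `lit galaxy search "read-once determinants" --star all` (1: panama FCT 2015
volume = AravindJoglekar2015);
`lit galaxy search "principal minor assignment problem" --star all` (6: arXiv:2309.00806 Al Ahmadieh
fibre of the principal minor map,
arXiv:1503.05799 Wheeler principal minor ideals, arXiv:1501.01266 Oeding; rest noise); `lit galaxy
search "Gaussian extent" --star all`
(DiasKoenig2024 the only relevant of 8); `lit galaxy search "fermionic linear optics" --star all`
(7, none on permanent/boson states);
`lit galaxy search "inequality of Hadamard type for permanents" --star all` (3, none relevant beyond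
CLL itself); `lit read arxiv:1508.06511
--grep` (Thm 1 read-k ⇒ dc ≤ nk, Thm 2 per_n ∉ ROD(ℝ) n > 5, S_4^2 argument p. 8 fails over ℂ); `lit
search` / `lit frontier` unavailable
(searchd rc 75, 18:59–19:10Z) — the card's own searches (arXiv/crossref: Aravind–Joglekar,
Dias–König, Hebenstreit et al.; hub cards grep)
stand; all sibling Theses of the sub read for overlap (OneNatPerBit: circuits/row-ABPs/monotone
rungs, no principal-minor or free-fermion
class; PrincipalMinorColouring: EXACT total rank, no angle; FermionicJet / FermionizationDimension /
TwistedDetRank: other objects).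
Nearest prior art found: CarlenLiebLoss2006 (doi:10.4310/maa.2006.v13.n1.a1; the diagonal-kernel
case of ReadOnceDecay and its rate);
AravindJoglekar2015 (arXiv:1508.06511; exact read-once non-expressibility over ℝ, n > 5, ℂ open, no
homogeneous-component relaxation, no
corr  [refs: 10.4310/maa.2006.v13.n1.a1, 2309.00806, 1503.05799, 1501.01266, 1508.06511, arxiv:1508.06511, doi:10.4310/maa.2006.v13.n1.a1, AravindJoglekar2015, DiasKoenig2024, CarlenLiebLoss2006, IkenmeyerLandsberg2017, BravyiEtAl2019]

Barriers (technique_class: correlation-bounds, free-fermions, extremal-inequality): - technique_class: correlation-bounds, free-fermions, extremal-inequality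
- Literature.Barriers.ValiantsHypothesis.AlgebraicNaturalProofs: corr²(·, per_n) ≤ ε is an
inequality satisfied BY the easy class, not a poly-size vanishing distinguisher, and {corr² > ε} is
a thin neighbourhood of one direction — not a large/constructive property; ReadOnceDecay moreover
concerns one explicit variety (principal minors of order n of n²×n² matrices), where natural-proof
considerations do not arise.
- Literature.Barriers.ValiantsHypothesis.FullRankMultilinear: conceded and turned around — degree-n
parts of generic read-once kernels have full flattening rank at every cut, so no rank method proves
ReadOnceDecay; the line needs a non-rank (CLL-type analytic) argument, which is the point (cf.
OneNatPerBit SingleCutBound: rank gives (e/2)ⁿ less than the truth already at R = n², K diagonal).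
- Literature.Barriers.ValiantsHypothesis.RankMethods: same — the functional is an angle, not a rank;
the calibration k-column DP / Grenet shows the law is not a flattening statement (flat permanent
flattening spectra give only w/C(n,k)).
- Literature.Barriers.ValiantsHypothesis.MonotoneGap: the CLL extremiser is monotone and optimal
among product states; the cruxes bound what signed, entangled kernels gain over it (≤ poly,
conjecturally) — a statement about cancellation inside VP-easy objects, not a monotone lower bound
transferred to general circuits.
- Literature.Barriers.ValiantsHypothesis.PartialDerivati

History (route lifecycle, newest last):
- 2026-08-16T04:20:38Z · AUTO-CRUX (backfill): PMCorrelationGap — hypotheses of the deciding theorem that nothing in the route derives are cruxes (operator:999:1085951)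
- 2026-08-22T06:19:30Z · DORMANT — reconciler: no traction for 5.1 d (last activity item-evidence-added at 2026-08-17T02:35:02Z); parked, not closed — `ledger route dormant route-ValiantsHypothes (operator:999:2414345)
- 2026-08-27T16:51:18Z · REACTIVATED — reconciler: reactivated — activity item-evidence-added at 2026-08-27T15:38:16Z after parking at 2026-08-22T06:19:30Z (operator:999:4090391)
- 2026-09-01T20:55:15Z · DORMANT — reconciler: no traction for 5 d (last activity statement-checked at 2026-08-27T19:48:46Z); parked, not closed — `ledger route dormant route-ValiantsHypothesis-F (operator:999:2022645)

sub-problem: ValiantsHypothesis · status: dormant · opened planner-plancard-ValiantsHypothesis-ValiantsH-7ce9d651-0 2026-08-15T19:22:51Z · rev 1 · ledger route-ValiantsHypothesis-FreeFermionCLL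
GENERATED by the gate from the ledger (D-0016/17). Provers cite these decls: `theorem foo : Summit.ValiantsHypothesis.ValiantsHypothesis.Theses.FreeFermionCLL.<Decl> := …` in Summits/ValiantsHypothesis/ValiantsHypothesis/Theorems/<Name>.lean.
-/

namespace Summit.ValiantsHypothesis.ValiantsHypothesis.Theses.FreeFermionCLL

open scoped BigOperators Topology Manifold Classical MeasureTheory ProbabilityTheory Matrix InnerProductSpace ComplexConjugate ContinuousMap
open Filter Set Function TopologicalSpace MeasureTheory

attribute [summit_statement] _root_.ValiantsHypothesis

open Literature.PNP

/-- item stmt-ValiantsHypothesis-13555 · crux (kind.auto-crux: conjecture-grade) · rank 0 · open · by planner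
why it might fail: Border-EVH strength: false if per_n is a qp-projection of DET (dc(per_n) = n^O(log n) is compatible with VP ≠ VNP) or merely lies in the ℓ²-closure of degree-n parts of qp-rank forms; nothing below Grenet's R = n·2^(n−1) is known.
sources: BurgisserClausenShokrollahi1997, Grenet2011, IkenmeyerLandsberg2017, MulmuleySohoniSIAM2001, CarlenLiebLoss2006
[target] X: for every c, eventually in n, every principal-minor form det(I_R + diag(x∘κ)K) of total
rank R ≤ 2^((log₂ n + c)^c) has 2·|permMass(P^(n))|² ≤ n!·coeffNormSq(P^(n)), i.e. corr²(P^(n),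
per_n) ≤ 1/2. -/
@[route_item "route-ValiantsHypothesis-FreeFermionCLL", crux]
def PMCorrelationGap : Prop :=
  ∀ c : ℕ, ∃ n₀ : ℕ, ∀ n ≥ n₀, ∀ R ≤ 2 ^ ((Nat.log 2 n + c) ^ c), ∀ (K : Matrix (Fin R) (Fin R) ℂ) (κ : Fin R → Fin n × Fin n), 2 * ‖Literature.Computability.AlgebraicComplexity.permMass n (MvPolynomial.homogeneousComponent n (1 + Matrix.diagonal (fun i => MvPolynomial.X (κ i)) * K.map (fun a : ℂ => (MvPolynomial.C a : MvPolynomial (Fin n × Fin n) ℂ))).det)‖ ^ 2 ≤ (n.factorial : ℝ) * Literature.Computability.AlgebraicComplexity.coeffNormSq n (MvPolynomial.homogeneousComponent n (1 + Matrix.diagonal (fun i => MvPolynomial.X (κ i)) * K.map (fun a : ℂ => (MvPolynomial.C a : MvPolynomial (Fin n × Fin n) ℂ))).det)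

/-- item stmt-ValiantsHypothesis-13556 · crux · rank 2 · open · by planner
why it might fail: n = 3 attains corr = 1 (CubicReadOnce) and n = 4 reaches ≥ 0.43 ≈ 4.6× CLL numerically (card); an algebraic family of complex kernels with corr² ≥ n^(−O(1)) — 3-cycle-type cancellations beyond the graph kernel — kills it together with ExpRankLaw and X.
sources: CarlenLiebLoss2006, AravindJoglekar2015, DiasKoenig2024, HebenstreitEtAl2019, BravyiEtAl2019, ValiantsHypothesis/ValiantsHypothesis/free-fermion-cll
[crux] FREE-FERMION CLL (card K1): there are C and 0 < θ < 1 such that for all n and all K ∈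
ℂ^(n²×n²), |permMass([deg n] det(I + diag(x)K))|² ≤ C·θ^n·n!·coeffNormSq([deg n] det(I + diag(x)K))
— every read-once principal-minor polynomial (free-fermion / DPP partition function on the n² cells)
has degree-n part at squared cosine ≤ Cθ^n with per_n; diagonal K is Carlen–Lieb–Loss (rate n!/nⁿ),
conjectured sharp rate poly(n)·n!/nⁿ. [difficulty: L] -/
@[route_item "route-ValiantsHypothesis-FreeFermionCLL"]
def ReadOnceDecay : Prop :=
  ∃ (C : ℕ) (θ : ℝ), 0 < θ ∧ θ < 1 ∧ ∀ (n : ℕ) (K : Matrix (Fin n × Fin n) (Fin n × Fin n) ℂ), ‖Literature.Computability.AlgebraicComplexity.permMass n (MvPolynomial.homogeneousComponent n (1 + Matrix.diagonal (fun e : Fin n × Fin n => MvPolynomial.X e) * K.map (fun a : ℂ => (MvPolynomial.C a : MvPolynomial (Fin n × Fin n) ℂ))).det)‖ ^ 2 ≤ (C : ℝ) * θ ^ n * ((n.factorial : ℝ) * Literature.Computability.AlgebraicComplexity.coeffNormSq n (MvPolynomial.homogeneousComponent n (1 + Matrix.diagonal (fun e : Fin n × Fin n => MvPolynomial.X e)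 * K.map (fun a : ℂ => (MvPolynomial.C a : MvPolynomial (Fin n × Fin n) ℂ))).det))

/-- item stmt-ValiantsHypothesis-13557 · crux · rank 3 · open · by planner
why it might fail: Border strength again: one poly-rank family with corr² decaying slower than every θ^n (none known: twisted determinants ≤ nⁿ/n!², k-column DPs e^(k−n), partial Ryser sums T·n!/nⁿ) refutes it while VP ≠ VNP and even X may survive.
sources: IkenmeyerLandsberg2017, CarlenLiebLoss2006, Grenet2011, BurgisserClausenShokrollahi1997, ValiantsHypothesis/ValiantsHypothesis/correlation-law-nat-per-bit
[crux] EXCHANGE RATE LEFT FREE (card K3, load-bearing form): there are C and 0 < θ < 1 such that for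
all n, R, K ∈ ℂ^(R×R), κ : [R] → [n]², |permMass(P^(n))|² ≤ C·(R + n +
1)^C·θ^n·n!·coeffNormSq(P^(n)) for P = det(I_R + diag(x∘κ)K): total rank buys correlation with per_n
only polynomially against an exponential deficit. Implies X (ExpImpliesGap) and, at R = n²,
ReadOnceDecay up to reindexing and a polynomial factor. [deps: ReadOnceDecay] [difficulty:
open-problem] -/
@[route_item "route-ValiantsHypothesis-FreeFermionCLL"]
def ExpRankLaw : Prop :=
  ∃ (C : ℕ) (θ : ℝ), 0 < θ ∧ θ < 1 ∧ ∀ (n R : ℕ) (K : Matrix (Fin R) (Fin R) ℂ) (κ : Fin R → Fin n × Fin n), ‖Literature.Computability.AlgebraicComplexity.permMass n (MvPolynomial.homogeneousComponent n (1 + Matrix.diagonal (fun i => MvPolynomial.X (κ i)) * K.map (fun a : ℂ => (MvPolynomial.C a : MvPolynomial (Fin n × Fin n) ℂ))).det)‖ ^ 2 ≤ (C : ℝ) * ((R : ℝ) + n + 1) ^ C * θ ^ n * ((n.factorial : ℝ) * Literature.Computability.AlgebraicComplexity.coeffNormSq n (MvPolynomial.homogeneousComponent n (1 + Matrix.diagonal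 (fun i => MvPolynomial.X (κ i)) * K.map (fun a : ℂ => (MvPolynomial.C a : MvPolynomial (Fin n × Fin n) ℂ))).det))

/-- item stmt-ValiantsHypothesis-13558 · crux · rank 4 · open · by planner
why it might fail: The exponent log₂ e is pinned only by three calibrations; any determinantal expression of per_n of total rank 2^n/n^ω(1) (none known; Grenet 2^n − 1 is the record) or a numerically growing excess over (R+1)^(log₂ e)·n!/nⁿ inside FF_n refutes it (ExpRankLaw survives).
sources: CarlenLiebLoss2006, Grenet2011, Glynn2010, JerrumSnir1982, AravindJoglekar2015
[crux] ONE NAT PER BIT OF TOTAL RANK (card K3, sharp form): there is C such that for all n ≥ 1, R,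
K, κ, |permMass(P^(n))|² ≤ C·n^C·e^(−n)·(R+1)^(1/ln 2)·n!·coeffNormSq(P^(n)): intercept = the
free-fermion rung at the CLL rate, slope e per doubling of total rank (k-column dynamic programme: R
≈ n²2^k, corr² = (n−k)!/(n−k)^(n−k)), endpoint Grenet/Ryser (R ≈ n·2^(n−1), corr = 1) exactly on the
line; implies dc(per_n) ≥ 2^n/poly(n) and ExpRankLaw (SharpImpliesExp). [deps: ExpRankLaw]
[difficulty: open-problem] -/
@[route_item "route-ValiantsHypothesis-FreeFermionCLL"]
def SharpRankLaw : Prop :=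
  ∃ C : ℕ, ∀ (n R : ℕ) (K : Matrix (Fin R) (Fin R) ℂ) (κ : Fin R → Fin n × Fin n), 1 ≤ n → ‖Literature.Computability.AlgebraicComplexity.permMass n (MvPolynomial.homogeneousComponent n (1 + Matrix.diagonal (fun i => MvPolynomial.X (κ i)) * K.map (fun a : ℂ => (MvPolynomial.C a : MvPolynomial (Fin n × Fin n) ℂ))).det)‖ ^ 2 ≤ (C : ℝ) * (n : ℝ) ^ C * Real.exp (-(n : ℝ)) * ((R : ℝ) + 1) ^ (1 / Real.log 2) * ((n.factorial : ℝ) * Literature.Computability.AlgebraicComplexity.coeffNormSq n (MvPolynomial.homogeneousComponent n (1 + Matrix.diagonal (fun i => MvPolynomial.X (κ i)) * K.map (fun a : ℂ => (MvPolynomial.C a : MvPolynomial (Fin n × Fin n) ℂ))).det))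

/-- item stmt-ValiantsHypothesis-13559 · support · rank 9 · closed · proved by Summit.ValiantsHypothesis.ValiantsHypothesis.Theorems.FreeFermionCLL.sharpImpliesExp_proof @ 38401cba32e6 (prover) · by planner
sources: CarlenLiebLoss2006
[support] SharpRankLaw → ExpRankLaw with θ = e⁻¹ and C' = C + 2 (n^C ≤ (R+n+1)^C, (R+1)^(1/ln 2) ≤
(R+n+1)², Real.rpow bookkeeping; n = 0 handled by C ≥ 1). [difficulty: provable-now] -/
@[route_item "route-ValiantsHypothesis-FreeFermionCLL"]
def SharpImpliesExp : Prop :=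
  SharpRankLaw → ExpRankLaw

-- `SharpImpliesExp` holds: proved by `Summit.ValiantsHypothesis.ValiantsHypothesis.Theorems.FreeFermionCLL.sharpImpliesExp_proof` @ 38401cba32e6 (its module imports this route file, so no `_holds` link can be stated here).

/-- item stmt-ValiantsHypothesis-13560 · support · rank 9 · closed · proved by Summit.ValiantsHypothesis.ValiantsHypothesis.Theorems.FreeFermionCLL.expImpliesGap_proof @ 451e0227cd08 (prover) · by planner
sources: Burgisser2000
[support] ExpRankLaw → PMCorrelationGap: for R ≤ 2^((log₂ n + c)^c) the factor C(R+n+1)^C θ^n is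
eventually ≤ 1/2 because (log₂ n + c)^c = o(n) (exponential beats quasi-polynomial; elementary real
analysis with Nat.log). [difficulty: provable-now] -/
@[route_item "route-ValiantsHypothesis-FreeFermionCLL"]
def ExpImpliesGap : Prop :=
  ExpRankLaw → PMCorrelationGap

-- `ExpImpliesGap` holds: proved by `Summit.ValiantsHypothesis.ValiantsHypothesis.Theorems.FreeFermionCLL.expImpliesGap_proof` @ 451e0227cd08 (its module imports this route file, so no `_holds` link can be stated here).

/-- item stmt-ValiantsHypothesis-13561 · support · rank 9 · closed · proved by Summit.ValiantsHypothesis.ValiantsHypothesis.Theorems.FreeFermionCLL.gapRefutesQP_proof @ 714f22529cac (prover) · by planner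
sources: MignonRessayre2004, IkenmeyerLandsberg2017, Literature.Computability.AlgebraicComplexity.perPoly_isHomogeneous
[support] PMCorrelationGap → TotalRankLeDc → QpArith → dc(per_n) is not quasi-polynomially bounded:
a qp bound on dc gives (TotalRankLeDc, QpArith) a principal-minor form of qp total rank with
per_n(x+J) = n!·P, whose degree-n component is per_n/n! (perPoly_isHomogeneous; top component is
translation invariant; homogeneousComponent of C c * P), so permMass = 1 and n!·coeffNormSq = 1,
contradicting 2 ≤ 1 at a large n. [difficulty: provable-now] -/
@[route_item "route-ValiantsHypothesis-FreeFermionCLL", crux]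
def GapRefutesQP : Prop :=
  PMCorrelationGap → (∀ n : ℕ, ∃ R ≤ n ^ 2 * Literature.Computability.AlgebraicComplexity.determinantalComplexity (Literature.Computability.AlgebraicComplexity.perPoly (Fin n) ℂ), ∃ (K : Matrix (Fin R) (Fin R) ℂ) (κ : Fin R → Fin n × Fin n), MvPolynomial.aeval (fun e => MvPolynomial.X e + 1) (Literature.Computability.AlgebraicComplexity.perPoly (Fin n) ℂ) = MvPolynomial.C (n.factorial : ℂ) * (1 + Matrix.diagonal (fun i => MvPolynomial.X (κ i)) * K.map (fun a : ℂ => (MvPolynomial.C a : MvPolynomial (Fin n × Fin n) ℂ))).det) → (∀ c : ℕ, ∃ c' : ℕ, ∀ n : ℕ, n ^ 2 * 2 ^ ((Nat.log 2 n + c) ^ c) ≤ 2 ^ ((Nat.log 2 n + c') ^ c')) → ¬ Literature.Computability.AlgebraicComplexity.IsQPBounded (fun n => Literature.Computability.AlgebraicComplexity.determinantalComplexity (Literature.Computability.AlgebraicComplexity.perPoly (Fin n) ℂ))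

-- `GapRefutesQP` holds: proved by `Summit.ValiantsHypothesis.ValiantsHypothesis.Theorems.FreeFermionCLL.gapRefutesQP_proof` @ 714f22529cac (its module imports this route file, so no `_holds` link can be stated here).

/-- item stmt-ValiantsHypothesis-13562 · support · rank 9 · closed · proved by Summit.ValiantsHypothesis.ValiantsHypothesis.Theorems.FreeFermionCLLCubicReadOnce.cubicReadOnce_proof (prover) · by planner
sources: AravindJoglekar2015, ValiantsHypothesis/ValiantsHypothesis/free-fermion-cll
[support] per_3 IS half the cubic component of a read-once integer principal-minor polynomial: [deg
3] det(I_9 + diag(x)·A₃) = 2·per_3, A₃(e,e') = 1 iff the cells e, e' share neither row nor column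
(zero diagonal): a 3×3 principal minor of a zero-diagonal matrix is the sum of its two directed
3-cycles, nonzero iff the three cells are pairwise non-attacking, i.e. a transversal. The threshold
identity n* ≥ 3 of the card, in closed form (the card's numerical kernel had 46 nonzero entries).
[difficulty: provable-now] -/
@[route_item "route-ValiantsHypothesis-FreeFermionCLL"]
def CubicReadOnce : Prop :=
  MvPolynomial.homogeneousComponent 3 (1 + Matrix.diagonal (fun e : Fin 3 × Fin 3 => MvPolynomial.X e) * (Matrix.of fun e e' : Fin 3 × Fin 3 => if e.1 = e'.1 ∨ e.2 = e'.2 then (0 : ℂ) else 1).map (fun a : ℂ => (MvPolynomial.C a : MvPolynomial (Fin 3 × Fin 3) ℂ))).det = MvPolynomial.C (2 : ℂ) * Literature.Computability.AlgebraicComplexity.perPoly (Fin 3) ℂ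

-- `CubicReadOnce` holds: proved by `Summit.ValiantsHypothesis.ValiantsHypothesis.Theorems.FreeFermionCLLCubicReadOnce.cubicReadOnce_proof` (its module imports this route file, so no `_holds` link can be stated here).

/-- item stmt-ValiantsHypothesis-13563 · support · rank 9 · open · by planner
sources: AravindEtAl2026, arXiv:2309.00806, arXiv:1503.05799, AravindJoglekar2015, ValiantsHypothesis/ValiantsHypothesis/free-fermion-cll
[support] threshold n* = 3: no K ∈ ℂ^(16×16) has [deg 4] det(I + diag(x)K) = c·per_4 with c ≠ 0
(1820 quartic minor conditions on 256 − 15 effective parameters; the graph kernel fails via the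
(ac)(bd) derangement, rank-4 kernels K = UVᵀ with partition frames fail by Pólya's sign obstruction;
general kernels open — numerical algebraic geometry / principal-minor-assignment structure). Either
answer is informative; a kernel that exists moves n* and threatens ReadOnceDecay. [difficulty: M] -/
@[route_item "route-ValiantsHypothesis-FreeFermionCLL"]
def NoQuarticReadOnce : Prop :=
  ∀ (K : Matrix (Fin 4 × Fin 4) (Fin 4 × Fin 4) ℂ) (c : ℂ), MvPolynomial.homogeneousComponent 4 (1 + Matrix.diagonal (fun e : Fin 4 × Fin 4 => MvPolynomial.X e) * K.map (fun a : ℂ => (MvPolynomial.C a : MvPolynomial (Fin 4 × Fin 4) ℂ))).det = MvPolynomial.C c * Literature.Computability.AlgebraicComplexity.perPoly (Fin 4) ℂ → c = 0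

/-- item stmt-ValiantsHypothesis-3784 · support · rank 9 · closed · proved by Summit.ValiantsHypothesis.ValiantsHypothesis.Theorems.PrincipalMinorColouring_TotalRankLeDc_proof @ 6c70fe169b17 (prover) · by planner
sources: IkenmeyerLandsberg2017, MignonRessayre2004, AravindJoglekar2015
[support] glue (provable now from NormalForm, hasDetRepr_determinantalComplexity_holds and rank ≤
size): for every n there is a principal-minor representation of per_n(x+J) of size ≤ n²·dc(per_n).
[difficulty: provable-now] -/
@[route_item "route-ValiantsHypothesis-FreeFermionCLL", crux]
def TotalRankLeDc : Prop :=
  ∀ n : ℕ, ∃ R ≤ n ^ 2 * Literature.Computability.AlgebraicComplexity.determinantalComplexity (Literature.Computability.AlgebraicComplexity.perPoly (Fin n) ℂ), ∃ (K : Matrix (Fin R) (Fin R) ℂ) (κ : Fin R → Fin n × Fin n), MvPolynomial.aeval (fun e => MvPolynomial.X e + 1) (Literature.Computability.AlgebraicComplexity.perPoly (Fin n) ℂ) = MvPolynomial.C (n.factorial : ℂ) * (1 + Matrix.diagonal (fun i => MvPolynomial.X (κ i)) * K.map (fun a : ℂ => (MvPolynomial.C a : MvPolynomial (Fin n × Fin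 n) ℂ))).det

-- `TotalRankLeDc` holds: proved by `Summit.ValiantsHypothesis.ValiantsHypothesis.Theorems.PrincipalMinorColouring_TotalRankLeDc_proof` @ 6c70fe169b17 (its module imports this route file, so no `_holds` link can be stated here).

/-- item stmt-ValiantsHypothesis-3785 · support · rank 9 · closed · proved by Summit.ValiantsHypothesis.ValiantsHypothesis.Theorems.qpArith_proof (prover) · by planner
sources: Burgisser2000
[support] arithmetic glue (provable now): n² · 2^((log₂ n + c)^c) ≤ 2^((log₂ n + c')^c') for c' = c
+ 2 and all n. [difficulty: provable-now] -/
@[route_item "route-ValiantsHypothesis-FreeFermionCLL", crux]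
def QpArith : Prop :=
  ∀ c : ℕ, ∃ c' : ℕ, ∀ n : ℕ, n ^ 2 * 2 ^ ((Nat.log 2 n + c) ^ c) ≤ 2 ^ ((Nat.log 2 n + c') ^ c')

-- `QpArith` holds: proved by `Summit.ValiantsHypothesis.ValiantsHypothesis.Theorems.qpArith_proof` (its module imports this route file, so no `_holds` link can be stated here).

/-- item stmt-ValiantsHypothesis-3786 · support · rank 9 · closed · proved by Summit.ValiantsHypothesis.Theorems.dcqpToVH_proof_detQP @ aa57966d6490 (prover) · by planner
sources: BurgisserClausenShokrollahi1997, Valiant1979, Burgisser2000, Literature.Computability.AlgebraicComplexity.isQPBounded_determinantalComplexity_of_isVPFamily_holds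
[support] glue (provable now from PROVED cone facts): dc(per_n) not qp-bounded ⇒ VP ℂ ≠ VNP ℂ,
composing isQPBounded_determinantalComplexity_of_isVPFamily_holds (VP ⊆ VQP = qp-projections of DET,
BCS97 (21.27)/(21.40)), mem_VP_ofFintype_iff_holds, perFamily_mem_VNP_holds and
Hub.valiantsHypothesis_of_not_isVPFamily_per (Theorems/HubHub.lean); = route DetQP's Assembly with
its hypotheses discharged. [difficulty: provable-now] -/
@[route_item "route-ValiantsHypothesis-FreeFermionCLL", crux]
def DcqpToVH : Prop :=
  ¬ Literature.Computability.AlgebraicComplexity.IsQPBounded (fun n => Literature.Computability.AlgebraicComplexity.determinantalComplexity (Literature.Computability.AlgebraicComplexity.perPoly (Fin n) ℂ)) → ValiantsHypothesis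

-- `DcqpToVH` holds: proved by `Summit.ValiantsHypothesis.Theorems.dcqpToVH_proof_detQP` @ aa57966d6490 (its module imports this route file, so no `_holds` link can be stated here).

/-- item stmt-ValiantsHypothesis-13564 · assembly · rank 1 · closed · proved by Summit.ValiantsHypothesis.ValiantsHypothesis.Theorems.FreeFermionCLL.assembly_proof @ 700edbebebc8 (prover) · by planner
sources: BurgisserClausenShokrollahi1997, Burgisser2000
[assembly] PMCorrelationGap → GapRefutesQP → TotalRankLeDc → QpArith → DcqpToVH →
ValiantsHypothesis. -/
@[route_item "route-ValiantsHypothesis-FreeFermionCLL"]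
def Assembly : Prop :=
  PMCorrelationGap → GapRefutesQP → TotalRankLeDc → QpArith → DcqpToVH → ValiantsHypothesis

-- `Assembly` holds: proved by `Summit.ValiantsHypothesis.ValiantsHypothesis.Theorems.FreeFermionCLL.assembly_proof` @ 700edbebebc8 (its module imports this route file, so no `_holds` link can be stated here).

/-! D-0027 §2.1 — DECIDING THEOREM (planner-authored via `route open/edit --closes-file`; by planner-plancard-ValiantsHypothesis-ValiantsH-7ce9d651-0 2026-08-15T19:22:52Z):
its hypotheses are this route's items and its conclusion the sub-problem Statement (glue_lint), and it elaborates with this file. -/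

@[closes "route-ValiantsHypothesis-FreeFermionCLL"] theorem closes (h_PMCorrelationGap : PMCorrelationGap) (h_GapRefutesQP : GapRefutesQP)
    (h_TotalRankLeDc : TotalRankLeDc) (h_QpArith : QpArith) (h_DcqpToVH : DcqpToVH) :
    _root_.ValiantsHypothesis :=
  h_DcqpToVH (h_GapRefutesQP h_PMCorrelationGap h_TotalRankLeDc h_QpArith)

end Summit.ValiantsHypothesis.ValiantsHypothesis.Theses.FreeFermionCLL
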